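import Literature.NumberTheory.Automorphic.GKContragredient
import Literature.NumberTheory.Automorphic.AutomorphicRepsGLPeterssonAdmissible
import HarnessLib

/-!
# The infinitesimal character of the contragredient `(𝔤, K)`-module

Topic `NumberTheory/Automorphic`; namespace `Literature.NumberTheory.Automorphic.GKDual`.
Theorems and two auxiliary algebra homomorphisms (no named fact, no `sorry`); companion of
`GKContragredient` (the contragredient data `ρK.dual`, `GKDual.lie`, the `K`-finite dual
`GKDual.carrier` with `Kfin`, `lieFin`, and `GKDual.isGKModule`), using the tree's antipode
`antipode G : U(𝔤) →ₐ[ℝ] U(𝔤)ᵐᵒᵖ` (`AutomorphicRepsGLPeterssonAdmissible`, §1;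
Dixmier 2.2.4) and `HasInfinitesimalCharacter` (`GKModules`).

* `GKDual.envelopingAction_lie` — **`U(𝔤)` acts on `V^*` through the antipode**:
  `u • ℓ = ℓ ∘ ρ(S u)`, i.e. `⟨u v^*, v⟩ = ⟨v^*, uᵗ v⟩`
  [cite: KnappVogan1995, §VII.4, before Thm. 7.56]
  (both sides are algebra homomorphisms `U(𝔤) → End V^*` — the right-hand one is
  `GKDual.envelopingDual` — agreeing on `𝔤`);
* `GKDual.antipodeCenter G : Z(𝔤) →ₐ[ℝ] Z(𝔤)` — the antipode on the centre (an algebra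
  homomorphism there, `Z(𝔤)` being commutative and `S`-stable);
* `GKDual.hasInfinitesimalCharacter_dual` — **if `Z(𝔤)` acts on `V` by `θ`, it acts on `V^*`
  by `θ ∘ S`** [cite: KnappVogan1995, §VII.4, (7.55) and the paragraph preceding Thm. 7.56]
  (there phrased through `χ_λ ∘ t = χ_(-λ)`: the dual of a module with infinitesimal character
  `λ` has infinitesimal character `-λ`);
* `GKDual.coe_envelopingAction_lieFin` (the `U(𝔤)`-action on the `K`-finite dual is the
  restriction of that on `V^*`; `uea_induction`) and
  `GKDual.hasInfinitesimalCharacter_contragredient` — the same for the contragredient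
  `(𝔤, K)`-module `Ṽ` of `GKContragredient`
  [cite: KnappVogan1995, §II.3, (2.42) and Remark; §VII.4, (7.55)].

This is the hypothesis side of Wigner's lemma [cite: BorelWallach2000, I Thm. 5.3 (ii)]
(`H^q(𝔤, K; V ⊗ F) = 0` unless `χ_V = χ_F̃`) for contragredients.

## Mathlib / Literature search

Mathlib has `UniversalEnvelopingAlgebra` (`lift`, `ι`, `hom_ext`) but no antipode / Hopf structure
on it and no `(𝔤, K)`-modules; the antipode, `centerU`, `envelopingAction`,
`HasInfinitesimalCharacter` are the tree's (`lean search 'antipode|centerU|envelopingAction'`).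

## References

* A. W. Knapp, D. A. Vogan, *Cohomological Induction and Unitary Representations* (1995), §II.3
  (2.42) and Remark (the `K`-finite contragredient `V^c`); §VII.4, (7.55) (held) [KnappVogan1995].
* J. Dixmier, *Enveloping Algebras* (1977), 2.2.4 (principal anti-automorphism) [Dixmier1977].
* A. Borel, N. Wallach (2000), I Thm. 5.3 (held) [BorelWallach2000].
-/

noncomputable section

namespace Literature.NumberTheory.Automorphic

open Module UniversalEnvelopingAlgebra

-- Mathlib idiom (as in `GKModules`): commutator bracket on `Module.End`
attribute [local instance 100] LieRing.ofAssociativeRing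

variable {A : Type*} [NormedCommRing A] [NormedAlgebra ℝ A] [NormedAlgebra ℚ A] [CompleteSpace A]
  [StarRing A] {N : Type*} [Fintype N] [DecidableEq N] (G : RealMatrixGroup A N)
  {V : Type*} [AddCommGroup V] [Module ℂ V]
  (ρK : Representation ℂ G.maximalCompact V) (ρ𝔤 : G.lie →ₗ⁅ℝ⁆ Module.End ℂ V)

namespace GKDual

/-- The algebra homomorphism `u ↦ (ρ(S u))^t : U(𝔤) → End V^*` (transpose of the action of the
antipode). [cite: KnappVogan1995, §VII.4, before Thm. 7.56] -/
def envelopingDual : UniversalEnvelopingAlgebra ℝ G.lie →ₐ[ℝ] Module.End ℂ (Dual ℂ V) where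
  toFun u := (envelopingAction ρ𝔤 (antipode G u).unop).dualMap
  map_one' := by
    rw [map_one, MulOpposite.unop_one, map_one, Module.End.one_eq_id, LinearMap.dualMap_id]
    rfl
  map_mul' u v := by
    rw [map_mul, MulOpposite.unop_mul, map_mul, Module.End.mul_eq_comp,
      ← LinearMap.dualMap_comp_dualMap]
    rfl
  map_zero' := by
    rw [map_zero, MulOpposite.unop_zero, map_zero]
    ext ℓ v
    simp only [LinearMap.dualMap_apply, LinearMap.zero_apply, map_zero]
  map_add' u v := by
    rw [map_add, MulOpposite.unop_add, map_add]
    ext ℓ w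
    simp only [LinearMap.dualMap_apply, LinearMap.add_apply, map_add]
  commutes' r := by
    rw [AlgHom.commutes, MulOpposite.algebraMap_apply, MulOpposite.unop_op, AlgHom.commutes]
    ext ℓ v
    simp only [LinearMap.dualMap_apply, Module.algebraMap_end_apply, LinearMap.map_smul_of_tower,
      LinearMap.smul_apply]

/-- Unfolding. [folklore] -/
theorem envelopingDual_apply (u : UniversalEnvelopingAlgebra ℝ G.lie) :
    envelopingDual G ρ𝔤 u = (envelopingAction ρ𝔤 (antipode G u).unop).dualMap := rfl

/-- **`U(𝔤)` acts on the dual through the antipode**: `u • ℓ = ℓ ∘ ρ(S u)` for the action of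
`U(𝔤)` on `V^*` induced by the contragredient `𝔤`-action (`⟨u v^*, v⟩ = ⟨v^*, uᵗ v⟩`).
[cite: KnappVogan1995, §VII.4, before Thm. 7.56] -/
theorem envelopingAction_lie (u : UniversalEnvelopingAlgebra ℝ G.lie) :
    envelopingAction (lie G ρ𝔤) u = (envelopingAction ρ𝔤 (antipode G u).unop).dualMap := by
  have hΦ : envelopingAction (lie G ρ𝔤) = envelopingDual G ρ𝔤 := by
    apply UniversalEnvelopingAlgebra.hom_ext
    refine LieHom.ext fun X => ?_
    change envelopingAction (lie G ρ𝔤) (ι ℝ X) = envelopingDual G ρ𝔤 (ι ℝ X)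
    rw [envelopingAction_ι, envelopingDual_apply, antipode_ι, MulOpposite.unop_neg,
      MulOpposite.unop_op, map_neg, envelopingAction_ι]
    ext ℓ v
    simp only [lie_apply, LinearMap.dualMap_apply, LinearMap.neg_apply, map_neg]
  rw [hΦ, envelopingDual_apply]

/-- The antipode restricted to the centre `Z(𝔤)`, as an algebra homomorphism `Z(𝔤) → Z(𝔤)` (an
anti-homomorphism of a commutative algebra). Dixmier 2.2.4. [folklore] -/
def antipodeCenter : centerU G →ₐ[ℝ] centerU G where
  toFun z := ⟨(antipode G (z : UniversalEnvelopingAlgebra ℝ G.lie)).unop,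
    unop_antipode_mem_centerU z.2⟩
  map_one' := Subtype.ext (by
    change (antipode G 1).unop = 1
    rw [map_one, MulOpposite.unop_one])
  map_mul' z w := Subtype.ext (by
    change (antipode G ((z : UniversalEnvelopingAlgebra ℝ G.lie) * w)).unop =
      (antipode G (z : UniversalEnvelopingAlgebra ℝ G.lie)).unop * (antipode G (w : _)).unop
    rw [map_mul, MulOpposite.unop_mul]
    exact (Subalgebra.mem_center_iff.mp (unop_antipode_mem_centerU w.2) _).symm)
  map_zero' := Subtype.ext (by
    change (antipode G 0).unop = 0
    rw [map_zero, MulOpposite.unop_zero])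
  map_add' z w := Subtype.ext (by
    change (antipode G ((z : UniversalEnvelopingAlgebra ℝ G.lie) + w)).unop =
      (antipode G (z : UniversalEnvelopingAlgebra ℝ G.lie)).unop + (antipode G (w : _)).unop
    rw [map_add, MulOpposite.unop_add])
  commutes' r := Subtype.ext (by
    change (antipode G (algebraMap ℝ _ r)).unop = algebraMap ℝ _ r
    rw [AlgHom.commutes, MulOpposite.algebraMap_apply, MulOpposite.unop_op])

/-- Unfolding. [folklore] -/
@[simp] theorem coe_antipodeCenter (z : centerU G) :
    (antipodeCenter G z : UniversalEnvelopingAlgebra ℝ G.lie) =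
      (antipode G (z : UniversalEnvelopingAlgebra ℝ G.lie)).unop := rfl

/-- **The dual has infinitesimal character `θ ∘ S`.** If `Z(𝔤)` acts on `V` through
`θ : Z(𝔤) → ℂ`, then it acts on `V^*` (contragredient `𝔤`-action) through `θ ∘ S`, `S` the
antipode. [cite: KnappVogan1995, §VII.4, (7.55)] -/
theorem hasInfinitesimalCharacter_dual {θ : centerU G →ₐ[ℝ] ℂ}
    (hθ : HasInfinitesimalCharacter ρ𝔤 θ) :
    HasInfinitesimalCharacter (lie G ρ𝔤) (θ.comp (antipodeCenter G)) := by
  intro z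
  rw [envelopingAction_lie, AlgHom.comp_apply, ← coe_antipodeCenter, hθ (antipodeCenter G z)]
  ext ℓ v
  simp only [LinearMap.dualMap_apply, Module.algebraMap_end_apply, map_smul, smul_eq_mul,
    LinearMap.smul_apply]

/-- Induction principle for `U(𝔤)` (scalars, `𝔤`, products, sums): `U(𝔤)` is a quotient of the
tensor algebra (`RingCon.mkₐ_surjective`, `TensorAlgebra.induction`). [folklore] -/
theorem uea_induction {R L : Type*} [CommRing R] [LieRing L] [LieAlgebra R L]
    {C : UniversalEnvelopingAlgebra R L → Prop}
    (algebraMap : ∀ r, C (algebraMap R _ r)) (hι : ∀ x, C (ι R x))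
    (mul : ∀ a b, C a → C b → C (a * b)) (add : ∀ a b, C a → C b → C (a + b))
    (u : UniversalEnvelopingAlgebra R L) : C u := by
  obtain ⟨t, rfl⟩ := RingCon.mkₐ_surjective (α := R) (UniversalEnvelopingAlgebra.ringCon R L) u
  change C (mkAlgHom R L t)
  induction t using TensorAlgebra.induction with
  | algebraMap r => rw [AlgHom.commutes]; exact algebraMap r
  | ι x => exact hι x
  | mul a b ha hb => rw [map_mul]; exact mul _ _ ha hb
  | add a b ha hb => rw [map_add]; exact add _ _ ha hb

/-- The action of `U(𝔤)` on the `K`-finite dual is the restriction of its action on `V^*`.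
[cite: KnappVogan1995, §II.3, (2.42) and Remark] -/
theorem coe_envelopingAction_lieFin [Module.Finite ℝ G.lie]
    (had : ∀ (k : G.maximalCompact) (X : G.lie),
      ρK k ∘ₗ ρ𝔤 X ∘ₗ ρK k⁻¹ = ρ𝔤 (G.Ad (Subgroup.inclusion G.maximalCompact_le_carrier k) X))
    (u : UniversalEnvelopingAlgebra ℝ G.lie) (ℓ : carrier G ρK) :
    (envelopingAction (lieFin G ρK ρ𝔤 had) u ℓ : Dual ℂ V) = envelopingAction (lie G ρ𝔤) u ℓ := by
  induction u using uea_induction generalizing ℓ with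
  | algebraMap r =>
    rw [AlgHom.commutes, AlgHom.commutes, Module.algebraMap_end_apply,
      Module.algebraMap_end_apply, Submodule.coe_smul_of_tower]
  | hι X => rw [envelopingAction_ι, envelopingAction_ι, coe_lieFin_apply]
  | mul a b ha hb => rw [map_mul, map_mul, Module.End.mul_apply, Module.End.mul_apply, ha, hb]
  | add a b ha hb =>
    rw [map_add, map_add, LinearMap.add_apply, LinearMap.add_apply, Submodule.coe_add, ha, hb]

/-- **The contragredient `(𝔤, K)`-module has infinitesimal character `θ ∘ S`.**
[cite: KnappVogan1995, §VII.4, (7.55)] -/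
theorem hasInfinitesimalCharacter_contragredient [Module.Finite ℝ G.lie]
    (had : ∀ (k : G.maximalCompact) (X : G.lie),
      ρK k ∘ₗ ρ𝔤 X ∘ₗ ρK k⁻¹ = ρ𝔤 (G.Ad (Subgroup.inclusion G.maximalCompact_le_carrier k) X))
    {θ : centerU G →ₐ[ℝ] ℂ} (hθ : HasInfinitesimalCharacter ρ𝔤 θ) :
    HasInfinitesimalCharacter (lieFin G ρK ρ𝔤 had) (θ.comp (antipodeCenter G)) := by
  intro z
  refine LinearMap.ext fun ℓ => Subtype.ext ?_
  rw [coe_envelopingAction_lieFin, hasInfinitesimalCharacter_dual G ρ𝔤 hθ z,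
    Module.algebraMap_end_apply, Module.algebraMap_end_apply, Submodule.coe_smul]

end GKDual

end Literature.NumberTheory.Automorphic
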